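import Summits.QuantumFields.YangMills.Theorems.ChatterjeeMassGapTorusAxialStrongCoupling
import Literature.MathematicalPhysics.QuantumFieldTheory.LatticeGaugeProofs
import Literature.MathematicalPhysics.QuantumLattice.ContinuumLimitLGT
import Literature.MathematicalPhysics.QuantumLattice.LatticeGaugeDLRLimitPointsProofs
import Literature.Barriers.QuantumFields.AbelianDeconfinementD4Proofs
import HarnessLib

/-!
# `β = 0`: the gap clause of the S28 torus–axial row fails, for every gauge group (record)

Companion to `ChatterjeeMassGapTorusAxialCore` (the re-typing `S28ᵀ ↔ gap core` given the
proved divergence `XiDiverges`, item 8941) and `ChatterjeeMassGapTorusAxialStrongCoupling` (the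
gap core on the strong-coupling island `0 ≤ β < β₀` modulo the non-degeneracy clause
`f(2e₀) ≠ 0`). Here the endpoint `β = 0` is settled completely, for EVERY compact metrisable
group `G` and every continuous matrix representation `ρ`:

* `wilsonMeasure_zero` — at `β = 0` the torus Wilson measure IS the Haar product;
* `integral_mul_of_dependsOn_disjoint` — under a product probability measure on torus
  configurations, observables depending on disjoint edge sets are uncorrelated (independence of
  coordinates, `iIndepFun_pi`);
* `wilsonExpectation_zero_mul` — hence `⟨F₁ F₂⟩_{L,0} = ⟨F₁⟩_{L,0} ⟨F₂⟩_{L,0}` for cylinder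
  observables with disjoint torus supports;
* `torusTruncatedPlaquette_eq_zero` — the torus truncated correlation of the origin plaquette
  with its axial translate by two units vanishes for every period `≥ 4` (the two plaquettes
  share no edge: `disjoint_plaquetteSupports_torus`);
* `plaquetteCorrFn_two_eq_zero_of_beta_zero`, `plaquetteCorrFn_axis_eq_zero_of_beta_zero` —
  for every torus-limit state `μ` at `β = 0`: `f_{0,μ}(2e₀) = 0`, hence (RP dichotomy)
  `f_{0,μ}(n e₀) = 0` for all `n ≥ 2`;
* `hasInvCorrLength_zero_of_beta_zero`, `not_posRate_of_beta_zero` — its axial inverse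
  correlation length is `0` (the degenerate branch is realised) and NO positive rate exists;
* `exists_limitState_beta_zero_degenerate`, `not_gapClause_at_beta_zero` — non-vacuously
  (Prokhorov): the gap clause "every torus-limit state has a positive axial rate" is FALSE at
  `β = 0`.

Reading for the registry lane (rows 5/6, `cqft.S28`): the hypothesis `0 < β` of the re-typed
row is sharp, and the non-degeneracy clause `f(2e₀) ≠ 0` of the gap core is a genuine clause —
at `β = 0` it fails for every group while the strong-coupling rate bound
(`S28TorusAxialStrong.gapCore_of_strongCoupling`, valid on `[0, β₀)`) holds vacuously; for
`β ≥ β₁` it is PROVED (`AxialCorrLength.axialCorrLengthDiverges`, positivity at all distances);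
on `(0, β₀)` it is the lowest-order cluster-expansion statement and is not claimed here. No
summit-level statement is touched; nothing about a mass gap at `β > 0` is asserted.

References: E. Seiler, LNP 159 (1982) Ch. 2 [SeilerLNP1982]; S. Chatterjee, arXiv:1803.01950,
§2 and Problem 5.1 [arXiv180301950].
-/

noncomputable section

open MeasureTheory Filter Topology ProbabilityTheory
open Literature.MathematicalPhysics.QuantumFieldTheory Literature.MathematicalPhysics.QuantumLattice
open Literature.Probability.LatticeModels (Site HasInvCorrLength Torus.proj Torus.proj_apply)
open Literature.Barriers.QuantumFields (plaquetteObs_configShift)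

namespace Summit.QuantumFields.YangMills.Theorems.S28BetaZero

variable {d : ℕ} {G : Type} [Group G] [TopologicalSpace G] [IsTopologicalGroup G] [CompactSpace G]
  [MeasurableSpace G] [BorelSpace G] {N : ℕ} (ρ : G →* Matrix (Fin N) (Fin N) ℂ)

/-- At `β = 0` the torus Wilson measure is the Haar product measure. [folklore] -/
theorem wilsonMeasure_zero (L : ℕ) [NeZero L] :
    wilsonMeasure (d := d) (L := L) ρ 0 = Measure.pi fun _ : Edge d L => haarProbability G := by
  have hw : wilsonWeight (d := d) (L := L) ρ 0 =
      Measure.pi fun _ : Edge d L => haarProbability G := by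
    have h1 : (fun U : GaugeConfig d L G =>
        ENNReal.ofReal (Real.exp (-0 * wilsonAction ρ U))) = 1 := by
      funext U; simp
    rw [wilsonWeight, h1, withDensity_one]
  have hZ : partitionFunction (d := d) (L := L) ρ 0 = 1 := by
    rw [partitionFunction, hw, measure_univ]
  rw [wilsonMeasure, hZ, inv_one, one_smul, hw]

omit [TopologicalSpace G] [IsTopologicalGroup G] [CompactSpace G] [BorelSpace G] in
/-- Under a product probability measure on torus configurations, two observables depending on
disjoint sets of edges are uncorrelated: `∫ X Y = ∫ X ∫ Y` (independence of the coordinates of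
a product measure). [folklore] -/
theorem integral_mul_of_dependsOn_disjoint (L : ℕ) [NeZero L] (π₀ : Measure G)
    [IsProbabilityMeasure π₀]
    {S T : Finset (Edge d L)} (hST : Disjoint S T)
    {X Y : GaugeConfig d L G → ℝ} (hX : DependsOn X ↑S) (hY : DependsOn Y ↑T)
    (hXm : Measurable X) (hYm : Measurable Y) :
    ∫ V, X V * Y V ∂(Measure.pi fun _ : Edge d L => π₀) =
      (∫ V, X V ∂(Measure.pi fun _ : Edge d L => π₀)) *
        ∫ V, Y V ∂(Measure.pi fun _ : Edge d L => π₀) := by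
  classical
  set π : Measure (GaugeConfig d L G) := Measure.pi fun _ : Edge d L => π₀ with hπ
  have hind : iIndepFun (fun (e : Edge d L) (V : GaugeConfig d L G) => V e) π := by
    have := iIndepFun_pi (μ := fun _ : Edge d L => π₀) (X := fun _ => (id : G → G))
      (fun _ => aemeasurable_id)
    simpa using this
  have hST' : IndepFun (fun (V : GaugeConfig d L G) (i : S) => V i)
      (fun (V : GaugeConfig d L G) (i : T) => V i) π :=
    hind.indepFun_finset S T hST fun e => measurable_pi_apply e
  set extS : (↥S → G) → GaugeConfig d L G := fun w e => if h : e ∈ S then w ⟨e, h⟩ else 1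
    with hextS
  set extT : (↥T → G) → GaugeConfig d L G := fun w e => if h : e ∈ T then w ⟨e, h⟩ else 1
    with hextT
  have hmS : Measurable extS := by
    refine measurable_pi_lambda _ fun e => ?_
    by_cases h : e ∈ S
    · simp only [hextS, dif_pos h]; exact measurable_pi_apply _
    · simp only [hextS, dif_neg h]; exact measurable_const
  have hmT : Measurable extT := by
    refine measurable_pi_lambda _ fun e => ?_
    by_cases h : e ∈ T
    · simp only [hextT, dif_pos h]; exact measurable_pi_apply _
    · simp only [hextT, dif_neg h]; exact measurable_const
  have hXf : X = (X ∘ extS) ∘ fun (V : GaugeConfig d L G) (i : S) => V i := by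
    funext V
    simp only [Function.comp_apply]
    refine hX fun e he => ?_
    simp only [hextS, dif_pos (Finset.mem_coe.1 he)]
  have hYf : Y = (Y ∘ extT) ∘ fun (V : GaugeConfig d L G) (i : T) => V i := by
    funext V
    simp only [Function.comp_apply]
    refine hY fun e he => ?_
    simp only [hextT, dif_pos (Finset.mem_coe.1 he)]
  have hXY : IndepFun X Y π := by
    rw [hXf, hYf]
    exact hST'.comp (hXm.comp hmS) (hYm.comp hmT)
  have key := hXY.integral_mul_eq_mul_integral hXm.aestronglyMeasurable hYm.aestronglyMeasurable
  simpa only [Pi.mul_apply] using key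

omit [Group G] [TopologicalSpace G] [IsTopologicalGroup G] [CompactSpace G] [MeasurableSpace G]
  [BorelSpace G] in
/-- The periodic restriction of a cylinder observable depends only on the torus images of its
support edges. [folklore] -/
theorem dependsOn_toTorusObservable (L : ℕ) {α : Type*} {F : LGConfig d G → α}
    {S : Finset (Literature.MathematicalPhysics.QuantumLattice.ZdEdge d)} (hF : IsCylinder F S) :
    DependsOn (toTorusObservable L F) ↑(S.image (torusEdge L)) := by
  intro V W hVW
  simp only [toTorusObservable, Function.comp_apply]
  refine hF fun e he => ?_
  simp only [torusLift, Function.comp_apply]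
  exact hVW _ (Finset.mem_coe.2 (Finset.mem_image_of_mem _ (Finset.mem_coe.1 he)))

/-- **At `β = 0` the torus Wilson expectation factorises over cylinder observables with disjoint
torus supports** (Haar product measure, independence of disjoint edge variables). [folklore] -/
theorem wilsonExpectation_zero_mul (L : ℕ) [NeZero L] {F₁ F₂ : LGConfig d G → ℝ}
    {S₁ S₂ : Finset (Literature.MathematicalPhysics.QuantumLattice.ZdEdge d)} (h₁ : IsCylinder F₁ S₁) (h₂ : IsCylinder F₂ S₂)
    (hm₁ : Measurable F₁) (hm₂ : Measurable F₂)
    (hdisj : Disjoint (S₁.image (torusEdge L)) (S₂.image (torusEdge L))) :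
    wilsonExpectation (L := L) ρ 0 (toTorusObservable L fun U => F₁ U * F₂ U) =
      wilsonExpectation (L := L) ρ 0 (toTorusObservable L F₁) *
        wilsonExpectation (L := L) ρ 0 (toTorusObservable L F₂) := by
  simp only [wilsonExpectation, wilsonMeasure_zero]
  exact integral_mul_of_dependsOn_disjoint L (haarProbability G) hdisj
    (dependsOn_toTorusObservable L h₁) (dependsOn_toTorusObservable L h₂)
    (hm₁.comp (measurable_torusLift L)) (hm₂.comp (measurable_torusLift L))

omit [TopologicalSpace G] [IsTopologicalGroup G] [CompactSpace G] [MeasurableSpace G]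
  [BorelSpace G] in
/-- The plaquette observable at `y` in the `(i, j)` plane is a cylinder function of its four
edges `(y, i), (y + eᵢ, j), (y + eⱼ, i), (y, j)`. [folklore] -/
theorem isCylinder_plaquetteObs_at (y : Site d) (i j : Fin d) :
    IsCylinder (plaquetteObs (G := G) ρ y i j)
      ({(y, i), (y + Pi.single i 1, j), (y + Pi.single j 1, i), (y, j)} : Finset (Literature.MathematicalPhysics.QuantumLattice.ZdEdge d)) := by
  intro U V hUV
  have h1 := hUV (y, i) (by simp)
  have h2 := hUV (y + Pi.single i 1, j) (by simp)
  have h3 := hUV (y + Pi.single j 1, i) (by simp)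
  have h4 := hUV (y, j) (by simp)
  simp only [plaquetteObs, plaquetteHolonomyZd, h1, h2, h3, h4]

/-- Torus images of edges whose base points have first coordinate in `{0, 1}` resp. `{2, 3}`
are distinct as soon as the period is at least `4`. [folklore] -/
theorem torusEdge_ne_of_coord {L : ℕ} (hL : 4 ≤ L) {a b : Literature.MathematicalPhysics.QuantumLattice.ZdEdge 4}
    (ha : a.1 0 = 0 ∨ a.1 0 = 1) (hb : b.1 0 = 2 ∨ b.1 0 = 3) :
    torusEdge L a ≠ torusEdge L b := by
  intro hab
  have h : ((a.1 0 : ℤ) : ZMod L) = ((b.1 0 : ℤ) : ZMod L) := by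
    have := congrArg (fun e : Edge 4 L => e.1 0) hab
    simpa [torusEdge] using this
  rw [ZMod.intCast_eq_intCast_iff_dvd_sub] at h
  have h4 : (4 : ℤ) ≤ L := by exact_mod_cast hL
  rcases ha with ha | ha <;> rcases hb with hb | hb <;>
    · rw [ha, hb] at h
      have := Int.le_of_dvd (by norm_num) h
      omega

/-- The two-unit axial translate of the origin plaquette: its support and that of the origin
plaquette have disjoint torus images for period `≥ 4`. [folklore] -/
theorem disjoint_plaquetteSupports_torus {L : ℕ} (hL : 4 ≤ L) :
    Disjoint
      (({((0 : Site 4), (0 : Fin 4)), ((0 : Site 4) + Pi.single (0 : Fin 4) 1, (1 : Fin 4)),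
          ((0 : Site 4) + Pi.single (1 : Fin 4) 1, (0 : Fin 4)), ((0 : Site 4), (1 : Fin 4))} :
          Finset (Literature.MathematicalPhysics.QuantumLattice.ZdEdge 4)).image (torusEdge L))
      (({(((2 : ℕ) • Pi.single (0 : Fin 4) (1 : ℤ) : Site 4), (0 : Fin 4)),
          (((2 : ℕ) • Pi.single (0 : Fin 4) (1 : ℤ) : Site 4) + Pi.single (0 : Fin 4) 1, (1 : Fin 4)),
          (((2 : ℕ) • Pi.single (0 : Fin 4) (1 : ℤ) : Site 4) + Pi.single (1 : Fin 4) 1, (0 : Fin 4)),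
          (((2 : ℕ) • Pi.single (0 : Fin 4) (1 : ℤ) : Site 4), (1 : Fin 4))} :
          Finset (Literature.MathematicalPhysics.QuantumLattice.ZdEdge 4)).image (torusEdge L)) := by
  rw [Finset.disjoint_left]
  rintro e he₁ he₂
  simp only [Finset.mem_image] at he₁ he₂
  obtain ⟨a, ha, rfl⟩ := he₁
  obtain ⟨b, hb, hab⟩ := he₂
  refine torusEdge_ne_of_coord hL (a := a) (b := b) ?_ ?_ hab.symm
  · simp only [Finset.mem_insert, Finset.mem_singleton] at ha
    rcases ha with rfl | rfl | rfl | rfl <;> simp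
  · simp only [Finset.mem_insert, Finset.mem_singleton] at hb
    rcases hb with rfl | rfl | rfl | rfl <;> simp

/-- **At `β = 0` the torus truncated correlation of the origin plaquette with its axial
translate by two units vanishes identically** for every period `L ≥ 4`: the two plaquettes have
no edge in common and the `β = 0` Wilson measure is the Haar product. [folklore] -/
theorem torusTruncatedPlaquette_eq_zero [SecondCountableTopology G] (hρ : Continuous ρ)
    {L : ℕ} [NeZero L] (hL : 4 ≤ L) :
    wilsonExpectation (L := L) ρ 0
          (toTorusObservable L fun U =>
            plaquetteObs (d := 4) ρ 0 0 1 U *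
              plaquetteObs (d := 4) ρ 0 0 1
                (configShift (-((2 : ℕ) • Pi.single (0 : Fin 4) (1 : ℤ) : Site 4)) U)) -
        wilsonExpectation (L := L) ρ 0 (toTorusObservable L (plaquetteObs (d := 4) ρ 0 0 1)) *
          wilsonExpectation (L := L) ρ 0
            (toTorusObservable L
              (plaquetteObs (d := 4) ρ 0 0 1 ∘
                configShift (-((2 : ℕ) • Pi.single (0 : Fin 4) (1 : ℤ) : Site 4)))) = 0 := by
  set y : Site 4 := (2 : ℕ) • Pi.single (0 : Fin 4) (1 : ℤ) with hy
  have hshift : (plaquetteObs (d := 4) ρ 0 0 1 ∘ configShift (-y)) = plaquetteObs ρ y 0 1 := by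
    funext U
    rw [Function.comp_apply, plaquetteObs_configShift, sub_neg_eq_add, zero_add]
  have hshift' : (fun U => plaquetteObs (d := 4) ρ 0 0 1 U *
      plaquetteObs (d := 4) ρ 0 0 1 (configShift (-y) U)) =
      fun U => plaquetteObs (d := 4) ρ 0 0 1 U * plaquetteObs ρ y 0 1 U := by
    funext U; rw [← hshift]; rfl
  rw [hshift', hshift, sub_eq_zero]
  have hm : ∀ z : Site 4, Measurable (plaquetteObs (d := 4) ρ z 0 1) := fun z =>
    Literature.MathematicalPhysics.QuantumLattice.measurable_plaquetteObs ρ hρ z 0 1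
  have h0 := isCylinder_plaquetteObs_at (G := G) ρ (0 : Site 4) 0 1
  have h2 := isCylinder_plaquetteObs_at (G := G) ρ y 0 1
  exact wilsonExpectation_zero_mul ρ L h0 h2 (hm 0) (hm y)
    (by simpa only [hy] using disjoint_plaquetteSupports_torus hL)

/-! ### Torus-limit states at `β = 0`: the gap clause of `S28ᵀ` fails -/

/-- **At `β = 0` the plaquette two-point function of every torus-limit state vanishes at
distance two on the axis**: `f_{0,μ}(2e₀) = 0` (limit of the identically vanishing torus
truncated correlations, `torusTruncatedPlaquette_eq_zero`, through the weak convergence of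
torus states on continuous cylinder observables,
`S28TorusAxialStrong.abs_plaquetteCorrFn_le_of_eventually`). [folklore] -/
theorem plaquetteCorrFn_two_eq_zero_of_beta_zero [SecondCountableTopology G] (hρ : Continuous ρ)
    {μ : Measure (LGConfig 4 G)} (hμ : μ ∈ infiniteVolumeLimitPoints (d := 4) ρ 0) :
    plaquetteCorrFn ρ μ ((2 : ℕ) • Pi.single (0 : Fin 4) (1 : ℤ)) = 0 := by
  obtain ⟨Ls, hLs, hlim⟩ := hμ
  have key := S28TorusAxialStrong.abs_plaquetteCorrFn_le_of_eventually ρ hρ hlim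
    (-((2 : ℕ) • Pi.single (0 : Fin 4) (1 : ℤ) : Site 4)) (b := 0)
    (eventually_atTop.2 ⟨4, fun k hk => by
      have hL : 4 ≤ Ls k + 1 := le_trans hk ((hLs.id_le k).trans (Nat.le_succ _))
      rw [torusTruncatedPlaquette_eq_zero ρ hρ hL, abs_zero]⟩)
  rw [neg_neg] at key
  exact abs_nonpos_iff.1 key

/-- **At `β = 0` the two-point function of every torus-limit state vanishes on the whole axis
beyond distance one** (`f(2e₀) = 0` and the reflection-positivity dichotomy
`AxialCorrLength.axialRateDichotomy`). [folklore] -/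
theorem plaquetteCorrFn_axis_eq_zero_of_beta_zero [SecondCountableTopology G] (hρ : Continuous ρ)
    {μ : Measure (LGConfig 4 G)} (hμ : μ ∈ infiniteVolumeLimitPoints (d := 4) ρ 0)
    (n : ℕ) (hn : 2 ≤ n) :
    plaquetteCorrFn ρ μ ((n : ℤ) • Pi.single (0 : Fin 4) (1 : ℤ)) = 0 := by
  rcases AxialCorrLength.axialRateDichotomy G N ρ hρ 0 le_rfl μ hμ with hzero | ⟨hpos, -⟩
  · exact hzero n hn
  · exfalso
    have h2 := hpos 2
    rw [show (((2 : ℕ) : ℤ) • Pi.single (0 : Fin 4) (1 : ℤ) : Site 4) =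
        (2 : ℕ) • Pi.single (0 : Fin 4) (1 : ℤ) from (natCast_zsmul _ _),
      plaquetteCorrFn_two_eq_zero_of_beta_zero ρ hρ hμ] at h2
    exact lt_irrefl _ h2

/-- **At `β = 0` every torus-limit state has axial inverse correlation length `0`** in the
tree's typing (`-log|f(n e₀)|/n = -log 0/n = 0` for `n ≥ 2`, junk value `log 0 = 0`): the
degenerate branch of the dichotomy is realised. [folklore] -/
theorem hasInvCorrLength_zero_of_beta_zero [SecondCountableTopology G] (hρ : Continuous ρ)
    {μ : Measure (LGConfig 4 G)} (hμ : μ ∈ infiniteVolumeLimitPoints (d := 4) ρ 0) :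
    HasInvCorrLength (plaquetteCorrFn ρ μ) 0 := by
  refine (tendsto_const_nhds (x := (0 : ℝ))).congr' ?_
  filter_upwards [eventually_ge_atTop 2] with n hn
  rw [plaquetteCorrFn_axis_eq_zero_of_beta_zero ρ hρ hμ n hn]
  simp

/-- **The gap clause of `S28ᵀ` fails at `β = 0`:** no torus-limit state at `β = 0` has a
positive axial inverse correlation length (the rate is `0` and rates are unique). So the
hypothesis `0 < β` of the re-typed row is sharp, and the non-degeneracy clause `f(2e₀) ≠ 0` of
the gap core (`S28TorusAxial.s28TorusAxial_iff_gapCore`) cannot be dropped: at `β = 0` it fails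
for every group while the strong-coupling rate bound
(`S28TorusAxialStrong.gapCore_of_strongCoupling`) holds vacuously. [folklore] -/
theorem not_posRate_of_beta_zero [SecondCountableTopology G] (hρ : Continuous ρ)
    {μ : Measure (LGConfig 4 G)} (hμ : μ ∈ infiniteVolumeLimitPoints (d := 4) ρ 0) :
    ¬ ∃ m : ℝ, 0 < m ∧ HasInvCorrLength (plaquetteCorrFn ρ μ) m := by
  rintro ⟨m, hm, hrate⟩
  have h0 := hasInvCorrLength_zero_of_beta_zero ρ hρ hμ
  have : m = 0 := tendsto_nhds_unique hrate h0
  exact hm.ne' this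

/-- **Non-vacuous form.** For every compact metrisable group and continuous matrix
representation there IS a torus-limit state at `β = 0` (Prokhorov,
`infiniteVolumeLimitPoints_nonempty_holds`), and for it — as for all of them — `f(2e₀) = 0`,
the axial rate is `0`, and no positive rate exists. [folklore] -/
theorem exists_limitState_beta_zero_degenerate [T2Space G] [SecondCountableTopology G]
    (hρ : Continuous ρ) :
    ∃ μ ∈ infiniteVolumeLimitPoints (d := 4) ρ 0,
      plaquetteCorrFn ρ μ ((2 : ℕ) • Pi.single (0 : Fin 4) (1 : ℤ)) = 0 ∧
      HasInvCorrLength (plaquetteCorrFn ρ μ) 0 ∧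
      ¬ ∃ m : ℝ, 0 < m ∧ HasInvCorrLength (plaquetteCorrFn ρ μ) m := by
  obtain ⟨μ, hμ⟩ := infiniteVolumeLimitPoints_nonempty_holds (d := 4) ρ hρ 0
  exact ⟨μ, hμ, plaquetteCorrFn_two_eq_zero_of_beta_zero ρ hρ hμ,
    hasInvCorrLength_zero_of_beta_zero ρ hρ hμ, not_posRate_of_beta_zero ρ hρ hμ⟩

/-- **Sharpness of `0 < β` in `S28ᵀ` (gap clause restricted to `β = 0` is false).** The
statement "every torus-limit state at `β = 0` has a positive axial rate" is FALSE for every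
compact metrisable `G` and every continuous `ρ`. [folklore] -/
theorem not_gapClause_at_beta_zero [T2Space G] [SecondCountableTopology G] (hρ : Continuous ρ) :
    ¬ ∀ μ ∈ infiniteVolumeLimitPoints (d := 4) ρ 0,
        ∃ m : ℝ, 0 < m ∧ HasInvCorrLength (plaquetteCorrFn ρ μ) m := by
  intro h
  obtain ⟨μ, hμ, -, -, hno⟩ := exists_limitState_beta_zero_degenerate ρ hρ
  exact hno (h μ hμ)

end Summit.QuantumFields.YangMills.Theorems.S28BetaZero

end
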